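import Mathlib.Algebra.BigOperators.Ring.Finset
import Mathlib.Algebra.CharP.Two
import Mathlib.Data.ZMod.Basic
import Mathlib.Data.Finset.SymmDiff
import Mathlib.Order.SymmDiff
import HarnessLib

/-!
# Local consistency of expanding parity systems (Atserias–Dawar 2019, Lemma 3.5, by linear algebra)

Topic `Literature/ModelTheory/FiniteModelTheory`; support file for the discharge of the named fact
`AtseriasDawarOchremiak2021_hamiltonicity_countingWidth` (`CountingWidth.lean`). Step (A2) of that proof:
Duplicator's side strategy on a system of parity constraints.

A 3-XOR SYSTEM over `𝔽₂` is given by scopes `S : U → Finset V` (the variables of constraint `u`) and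
right-hand sides `b : U → ZMod 2`; constraint `u` reads `∑_{v ∈ S u} x_v = b u`. Atserias–Dawar 2019
(arXiv:1806.11307), Lemma 3.5 (= Lemma 5 of the arXiv text): "for every sufficiently large `n` there is a
matrix `A ∈ {0,1}^{m×n}`, `m = rn`, each row with exactly three ones, such that for every `b` the 3-XOR
instance `Ax = b` is `k`-locally satisfiable for `k ≤ γn`"; the matrix is the incidence matrix of a
bipartite unique-neighbour (= boundary) expander, and the printed proof goes through Ben-Sasson–Wigderson
width and the Atserias–Dalmau characterisation of width by the existential pebble game. Here the same
conclusion is proved DIRECTLY from boundary expansion by the standard symmetric-difference argument, in the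
form consumed by the transfer theorem `ckEquiv_of_consistencyFamily` (`CkEquivTransfer.lean`):

* `oddSupport S T` — the variables lying in an odd number of scopes of `T ⊆ U` (the support of the sum of
  the rows in `T`); `boundary S T ⊆ oddSupport S T` — those lying in exactly one (unique neighbours);
  `sum_scopes_eq_sum_oddSupport` — `∑_{u∈T} ∑_{v∈S u} f v = ∑_{v ∈ oddSupport T} f v` over `ZMod 2`;
  `oddSupport_symmDiff` — `oddSupport (T₁ ∆ T₂) = oddSupport T₁ ∆ oddSupport T₂`.
* `Good S b s dom f` — the partial assignment `f|dom` is CONSISTENT AT RADIUS `s`: every set `T` of at most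
  `s` constraints whose row-sum is supported inside `dom` has `∑_{u∈T} b u = ∑_{v ∈ oddSupport T} f v`
  (equivalently: `f|dom` together with any `≤ s` constraints is a satisfiable linear system).
* PROVED: `Good` is monotone in `dom` and depends only on `f|dom`; a good assignment satisfies every
  constraint whose scope lies in its domain (`Good.sum_scope_eq`); under `(s, q/p)`-boundary expansion
  (`q |T| ≤ p |∂T|` for `|T| ≤ s`, `q > 0`) the empty assignment is good (`good_empty`) and **every good
  assignment on fewer than `K` variables extends to any further variable** whenever `2pK ≤ qs`
  (`good_extend`: two sets `T₁, T₂` forcing a value on the new variable have `|Tᵢ| ≤ pK/q`, so goodness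
  applies to `T₁ ∆ T₂`, whose odd support avoids the new variable, and the two forced values agree).

## References

* A. Atserias, A. Dawar, *Definable inapproximability: new challenges for duplicator*, J. Log. Comput. 29
  (2019), arXiv:1806.11307, §3.2, Lemma 3.5 with Claims 3.6–3.7 (Lemma 5, Claims 6–7 of the arXiv text).
  Read: arXiv pp. 11–13.
* E. Ben-Sasson, A. Wigderson, *Short proofs are narrow — resolution made simple*, J. ACM 48 (2001), §5
  (boundary expansion; the closure/symmetric-difference technique).
-/

namespace Literature.ModelTheory.FiniteModelTheory

open Finset
open scoped symmDiff

namespace XorSystem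

variable {U V : Type*} [DecidableEq V]

/-! ### Sums over `ZMod 2` and symmetric differences -/

/-- A sum over `A ⊆ X` as a sum of an indicator over `X`. [folklore] -/
theorem sum_eq_sum_ite_mem {M : Type*} [AddCommMonoid M] {A X : Finset V} (h : A ⊆ X) (g : V → M) :
    ∑ x ∈ A, g x = ∑ x ∈ X, if x ∈ A then g x else 0 := by
  rw [← Finset.sum_filter, Finset.filter_mem_eq_inter, Finset.inter_eq_right.2 h]

/-- Over `ZMod 2`, the sum over a symmetric difference is the sum of the two sums (the intersection is
counted twice, i.e. not at all). [folklore] -/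
theorem sum_symmDiff_zmod_two (A B : Finset V) (g : V → ZMod 2) :
    ∑ x ∈ A ∆ B, g x = ∑ x ∈ A, g x + ∑ x ∈ B, g x := by
  have hA : A ⊆ A ∪ B := subset_union_left
  have hB : B ⊆ A ∪ B := subset_union_right
  have hAB : A ∆ B ⊆ A ∪ B := symmDiff_le_sup
  rw [sum_eq_sum_ite_mem hAB, sum_eq_sum_ite_mem hA, sum_eq_sum_ite_mem hB, ← Finset.sum_add_distrib]
  refine Finset.sum_congr rfl fun x _ => ?_
  by_cases hxA : x ∈ A <;> by_cases hxB : x ∈ B <;>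
    simp [Finset.mem_symmDiff, hxA, hxB, CharTwo.add_self_eq_zero]

/-! ### Odd support and boundary of a set of constraints -/

section Support

variable (S : U → Finset V)

/-- The parity of the number of scopes `S u`, `u ∈ T`, containing `v` (the `v`-th coordinate of the sum
of the rows of `T` over `𝔽₂`). [folklore] -/
def chi (T : Finset U) (v : V) : ZMod 2 :=
  ∑ u ∈ T, if v ∈ S u then 1 else 0

/-- **The odd support** of a set `T` of constraints: the variables lying in an odd number of the scopes
`S u`, `u ∈ T` — the support of `∑_{u ∈ T} (row u)` over `𝔽₂`. [folklore] -/
def oddSupport (T : Finset U) : Finset V :=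
  (T.biUnion S).filter fun v => chi S T v ≠ 0

/-- **The boundary** (unique-neighbour set) of `T`: the variables lying in exactly one scope `S u`,
`u ∈ T` (Ben-Sasson–Wigderson 2001, §5; Atserias–Dawar 2019, before Lemma 3.5: "`∂T` denotes the set of
vertices in `V` that are unique neighbours of `T`"). [cite: AtseriasDawar2019, §3.2 (unique-neighbour expander, ∂T)] -/
def boundary (T : Finset U) : Finset V :=
  (T.biUnion S).filter fun v => (T.filter fun u => v ∈ S u).card = 1

variable {S}

/-- `chi` counts the scopes containing `v`, modulo `2`. [folklore] -/
theorem chi_eq_card (T : Finset U) (v : V) :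
    chi S T v = ((T.filter fun u => v ∈ S u).card : ZMod 2) := by
  rw [chi, Finset.sum_boole]

/-- A variable of non-zero parity lies in some scope of `T`. [folklore] -/
theorem exists_mem_of_chi_ne_zero {T : Finset U} {v : V} (h : chi S T v ≠ 0) : ∃ u ∈ T, v ∈ S u := by
  by_contra hne
  exact h (Finset.sum_eq_zero fun u hu => if_neg fun hv => hne ⟨u, hu, hv⟩)

/-- Membership in the odd support is non-vanishing of the parity. [folklore] -/
theorem mem_oddSupport {T : Finset U} {v : V} : v ∈ oddSupport S T ↔ chi S T v ≠ 0 := by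
  rw [oddSupport, Finset.mem_filter, and_iff_right_iff_imp]
  intro h
  obtain ⟨u, hu, hv⟩ := exists_mem_of_chi_ne_zero h
  exact Finset.mem_biUnion.2 ⟨u, hu, hv⟩

/-- The parity is additive under symmetric difference. [folklore] -/
theorem chi_symmDiff [DecidableEq U] (T₁ T₂ : Finset U) (v : V) : chi S (T₁ ∆ T₂) v = chi S T₁ v + chi S T₂ v :=
  sum_symmDiff_zmod_two T₁ T₂ _

/-- **The odd support of a symmetric difference** is the symmetric difference of the odd supports (rows
add over `𝔽₂`). [folklore] -/
theorem oddSupport_symmDiff [DecidableEq U] (T₁ T₂ : Finset U) :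
    oddSupport S (T₁ ∆ T₂) = oddSupport S T₁ ∆ oddSupport S T₂ := by
  ext v
  rw [Finset.mem_symmDiff, mem_oddSupport, mem_oddSupport, mem_oddSupport, chi_symmDiff]
  have key : ∀ a c : ZMod 2, a + c ≠ 0 ↔ (a ≠ 0 ∧ ¬ c ≠ 0) ∨ (c ≠ 0 ∧ ¬ a ≠ 0) := by decide
  exact key _ _

/-- The boundary lies in the odd support (one is odd). [folklore] -/
theorem boundary_subset_oddSupport (T : Finset U) : boundary S T ⊆ oddSupport S T := by
  intro v hv
  rw [boundary, Finset.mem_filter] at hv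
  rw [mem_oddSupport, chi_eq_card, hv.2]
  decide

/-- The odd support of a single constraint is its scope. [folklore] -/
theorem oddSupport_singleton (u : U) : oddSupport S {u} = S u := by
  ext v
  rw [mem_oddSupport, chi, Finset.sum_singleton]
  by_cases hv : v ∈ S u <;> simp [hv]

/-- The odd support of no constraints is empty. [folklore] -/
theorem oddSupport_empty : oddSupport S (∅ : Finset U) = ∅ := by
  ext v; simp [mem_oddSupport, chi]

/-- **Summing the constraints of `T`**: `∑_{u ∈ T} ∑_{v ∈ S u} f v = ∑_{v ∈ oddSupport T} f v` over
`ZMod 2` (variables in an even number of scopes cancel). [folklore] -/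
theorem sum_scopes_eq_sum_oddSupport (T : Finset U) (f : V → ZMod 2) :
    ∑ u ∈ T, ∑ v ∈ S u, f v = ∑ v ∈ oddSupport S T, f v := by
  set X := T.biUnion S with hX
  have hsub : ∀ u ∈ T, S u ⊆ X := fun u hu => Finset.subset_biUnion_of_mem S hu
  calc ∑ u ∈ T, ∑ v ∈ S u, f v
      = ∑ u ∈ T, ∑ v ∈ X, if v ∈ S u then f v else 0 :=
        Finset.sum_congr rfl fun u hu => sum_eq_sum_ite_mem (hsub u hu) f
    _ = ∑ v ∈ X, ∑ u ∈ T, if v ∈ S u then f v else 0 := Finset.sum_comm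
    _ = ∑ v ∈ X, chi S T v * f v := by
        refine Finset.sum_congr rfl fun v _ => ?_
        rw [chi, Finset.sum_mul]
        exact Finset.sum_congr rfl fun u _ => (boole_mul _ _).symm
    _ = ∑ v ∈ X, if chi S T v ≠ 0 then f v else 0 := by
        refine Finset.sum_congr rfl fun v _ => ?_
        have key : ∀ a : ZMod 2, a ≠ 0 → a = 1 := by decide
        by_cases h : chi S T v = 0
        · simp [h]
        · rw [if_pos h, key _ h, one_mul]
    _ = ∑ v ∈ oddSupport S T, f v := by rw [oddSupport, Finset.sum_filter]

end Support

/-! ### Consistent partial assignments -/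

section Good

variable (S : U → Finset V) (b : U → ZMod 2) (s : ℕ)

/-- **Consistency at radius `s`** of the partial assignment `f|dom` with the system `(S, b)`: every set
`T` of at most `s` constraints whose row-sum is supported inside `dom` is satisfied in sum,
`∑_{u ∈ T} b u = ∑_{v ∈ oddSupport T} f v`. By linear algebra over `𝔽₂` this says that `f|dom` together
with any `≤ s` of the constraints is satisfiable — the positions from which Duplicator wins the existential
pebble game in Atserias–Dawar 2019, Lemma 3.5 / Claim 3.7. [cite: AtseriasDawar2019, Lemma 3.5 (k-local satisfiability of expanding systems)] -/
def Good (dom : Finset V) (f : V → ZMod 2) : Prop :=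
  ∀ T : Finset U, T.card ≤ s → oddSupport S T ⊆ dom → ∑ u ∈ T, b u = ∑ v ∈ oddSupport S T, f v

variable {S b s}

/-- Consistency is preserved under shrinking the domain. [folklore] -/
theorem Good.mono {dom dom' : Finset V} {f : V → ZMod 2} (h : Good S b s dom f) (hsub : dom' ⊆ dom) :
    Good S b s dom' f :=
  fun T hT hT' => h T hT (hT'.trans hsub)

/-- Consistency depends only on the values on the domain. [folklore] -/
theorem Good.congr {dom : Finset V} {f g : V → ZMod 2} (h : Good S b s dom f)
    (hfg : ∀ v ∈ dom, f v = g v) : Good S b s dom g := by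
  intro T hT hT'
  rw [h T hT hT']
  exact Finset.sum_congr rfl fun v hv => hfg v (hT' hv)

/-- Consistency is preserved under decreasing the radius. [folklore] -/
theorem Good.of_le {s' : ℕ} {dom : Finset V} {f : V → ZMod 2} (h : Good S b s dom f) (hs : s' ≤ s) :
    Good S b s' dom f :=
  fun T hT hT' => h T (hT.trans hs) hT'

/-- **A consistent assignment satisfies every constraint whose scope lies in its domain**
(radius `≥ 1`): `∑_{v ∈ S u} f v = b u`. [cite: AtseriasDawar2019, Lemma 3.2 (proof: "if x_r+x_s+x_t=b_i is
an equation in I … then v_r+v_s+v_t = b_i")] -/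
theorem Good.sum_scope_eq {dom : Finset V} {f : V → ZMod 2} (h : Good S b s dom f) (hs : 1 ≤ s)
    {u : U} (hu : S u ⊆ dom) : ∑ v ∈ S u, f v = b u := by
  have := h {u} (by simpa using hs) (by rwa [oddSupport_singleton])
  rw [oddSupport_singleton, Finset.sum_singleton] at this
  exact this.symm

variable {p q K : ℕ}

/-- **The empty assignment is consistent** on a boundary expander: a non-empty `T` with `|T| ≤ s` has a
non-empty boundary, hence a non-empty odd support (Atserias–Dawar 2019, Claim 3.6: "every set of at most
`αn` equations from `Ax=b` is satisfiable"). [cite: AtseriasDawar2019, Claim 3.6] -/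
theorem good_empty (hq : 0 < q)
    (hexp : ∀ T : Finset U, T.card ≤ s → q * T.card ≤ p * (boundary S T).card) (f : V → ZMod 2) :
    Good S b s ∅ f := by
  intro T hT hsub
  rcases T.eq_empty_or_nonempty with rfl | hne
  · simp [oddSupport_empty]
  · exfalso
    have h1 : 0 < q * T.card := Nat.mul_pos hq (Finset.card_pos.2 hne)
    have h2 : 0 < (boundary S T).card := by
      have := (hexp T hT)
      rcases Nat.eq_zero_or_pos (boundary S T).card with h0 | h0
      · rw [h0, mul_zero] at this; omega
      · exact h0
    obtain ⟨v, hv⟩ := Finset.card_pos.1 h2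
    exact Finset.notMem_empty v (hsub (boundary_subset_oddSupport T hv))

/-- **The extension property** (Atserias–Dawar 2019, Lemma 3.5 / Claim 3.7, proved by the
symmetric-difference argument instead of resolution width): on an `(s, q/p)`-boundary expander, with
`2pK ≤ qs`, a consistent assignment on fewer than `K` variables extends consistently to any further
variable. [cite: AtseriasDawar2019, Lemma 3.5] -/
theorem good_extend [DecidableEq U] (hq : 0 < q)
    (hexp : ∀ T : Finset U, T.card ≤ s → q * T.card ≤ p * (boundary S T).card)
    (hK : 2 * p * K ≤ q * s) {dom : Finset V} {f : V → ZMod 2} (hf : Good S b s dom f)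
    (hcard : dom.card < K) (v : V) :
    ∃ g : V → ZMod 2, Good S b s (insert v dom) g ∧ ∀ w ∈ dom, g w = f w := by
  classical
  by_cases hv : v ∈ dom
  · exact ⟨f, by rwa [Finset.insert_eq_of_mem hv], fun _ _ => rfl⟩
  -- admissible sets of constraints are small
  have hsize : ∀ T : Finset U, T.card ≤ s → oddSupport S T ⊆ insert v dom → q * T.card ≤ p * K := by
    intro T hT hsub
    refine (hexp T hT).trans (Nat.mul_le_mul_left _ ?_)
    calc (boundary S T).card ≤ (oddSupport S T).card := card_le_card (boundary_subset_oddSupport T)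
      _ ≤ (insert v dom).card := card_le_card hsub
      _ ≤ dom.card + 1 := Finset.card_insert_le _ _
      _ ≤ K := hcard
  -- the value forced on `v` by a candidate `T` (one whose odd support contains `v`)
  let val : Finset U → ZMod 2 := fun T => ∑ u ∈ T, b u + ∑ w ∈ (oddSupport S T).erase v, f w
  let Cand : Finset U → Prop := fun T =>
    T.card ≤ s ∧ oddSupport S T ⊆ insert v dom ∧ v ∈ oddSupport S T
  -- two candidates force the same value: apply consistency to their symmetric difference
  have hagree : ∀ T₁ T₂, Cand T₁ → Cand T₂ → val T₁ = val T₂ := by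
    rintro T₁ T₂ ⟨h₁s, h₁d, h₁v⟩ ⟨h₂s, h₂d, h₂v⟩
    have hΔcard : (T₁ ∆ T₂).card ≤ s := by
      have e1 := hsize T₁ h₁s h₁d
      have e2 := hsize T₂ h₂s h₂d
      refine Nat.le_of_mul_le_mul_left ?_ hq
      calc q * (T₁ ∆ T₂).card ≤ q * (T₁ ∪ T₂).card :=
            Nat.mul_le_mul_left _ (card_le_card symmDiff_le_sup)
        _ ≤ q * (T₁.card + T₂.card) := Nat.mul_le_mul_left _ (Finset.card_union_le _ _)
        _ = q * T₁.card + q * T₂.card := Nat.mul_add _ _ _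
        _ ≤ p * K + p * K := Nat.add_le_add e1 e2
        _ = 2 * p * K := by rw [Nat.mul_assoc, Nat.two_mul]
        _ ≤ q * s := hK
    have hΔsub : oddSupport S (T₁ ∆ T₂) ⊆ dom := by
      intro w hw
      rw [oddSupport_symmDiff, Finset.mem_symmDiff] at hw
      have hwv : w ≠ v := by
        rintro rfl
        rcases hw with ⟨-, h⟩ | ⟨-, h⟩
        · exact h h₂v
        · exact h h₁v
      have hw' : w ∈ insert v dom := by
        rcases hw with ⟨h, -⟩ | ⟨h, -⟩
        · exact h₁d h
        · exact h₂d h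
      exact (Finset.mem_insert.1 hw').resolve_left hwv
    have hgood := hf (T₁ ∆ T₂) hΔcard hΔsub
    have herase : oddSupport S T₁ ∆ oddSupport S T₂ =
        ((oddSupport S T₁).erase v) ∆ ((oddSupport S T₂).erase v) := by
      ext w
      simp only [Finset.mem_symmDiff, Finset.mem_erase]
      by_cases hw : w = v
      · subst hw; simp [h₁v, h₂v]
      · simp [hw]
    rw [sum_symmDiff_zmod_two, oddSupport_symmDiff, herase, sum_symmDiff_zmod_two] at hgood
    have hsum : val T₁ + val T₂ = 0 := by
      show (∑ u ∈ T₁, b u + ∑ w ∈ (oddSupport S T₁).erase v, f w) +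
            (∑ u ∈ T₂, b u + ∑ w ∈ (oddSupport S T₂).erase v, f w) = 0
      rw [add_add_add_comm, hgood]
      exact CharTwo.add_self_eq_zero _
    rwa [← CharTwo.sub_eq_add, sub_eq_zero] at hsum
  -- the chosen value and the extended assignment
  let a : ZMod 2 := if h : ∃ T, Cand T then val h.choose else 0
  refine ⟨Function.update f v a, fun T hT hsub => ?_, fun w hw =>
    Function.update_of_ne (ne_of_mem_of_not_mem hw hv) _ _⟩
  by_cases hvT : v ∈ oddSupport S T
  · have hc : Cand T := ⟨hT, hsub, hvT⟩
    have hex : ∃ T, Cand T := ⟨T, hc⟩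
    have ha : a = val T := by
      simp only [a, dif_pos hex]
      exact hagree _ _ hex.choose_spec hc
    rw [← Finset.insert_erase hvT, Finset.sum_insert (Finset.notMem_erase v _), Function.update_self]
    have hupd : ∑ x ∈ (oddSupport S T).erase v, Function.update f v a x =
        ∑ x ∈ (oddSupport S T).erase v, f x :=
      Finset.sum_congr rfl fun w hw => Function.update_of_ne (Finset.ne_of_mem_erase hw) _ _
    rw [hupd, ha]
    simp only [val]
    rw [add_assoc, CharTwo.add_self_eq_zero, add_zero]
  · have hsub' : oddSupport S T ⊆ dom := fun w hw =>
      (Finset.mem_insert.1 (hsub hw)).resolve_left (by rintro rfl; exact hvT hw)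
    rw [hf T hT hsub']
    exact Finset.sum_congr rfl fun w hw =>
      (Function.update_of_ne (by rintro rfl; exact hvT hw) _ _).symm

end Good

end XorSystem

end Literature.ModelTheory.FiniteModelTheory
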